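import Summits.QuantumFields.BalabanUV.Beta.CovariantTowerDecay

/-!
# Beta / CovariantTowerDecayCT — the COMBES–THOMAS STEP for the k-fold covariant tower operator
# Δ_U + Σ_{l≤k} a_l·G_lᵀG_l of the pv21 MODEL: weighted-ℓ² and ENTRYWISE exponential decay of its inverse AND of its
# DIRICHLET inverse on a region Ω₀, UNIFORM IN THE TRANSPORT U AND IN THE VOLUME, with an explicit admissible rate θ_k > 0
# (unit `b2b-balaban-beta-d4-p2`, GEN 4; companion of `CovariantTowerDecay`, whose header states scope and honesty clauses)

HONEST FRAMING: discharging `BetaPertH` makes Bałaban's UV stability UNCONDITIONAL — NOT the continuum limit, NOT the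
Clay problem.  HONEST DEPENDENCY (verbatim): «continuum YM on T⁴ ⇐ BetaPertH ∧ nine spine estimates (0/9 proved);
BetaPertH ⇐ (D1) ∧ (D4) ∧ CAP+tail; G-an2-4 gates asym, D1 and NE2/3/4.»  THIS MODULE DISCHARGES NOTHING of `BetaPertH`,
asserts NOTHING printed and cites nothing as a fact (ABSOLUTE RULE): every declaration is a [folklore] kernel theorem
about the component MODEL of the pv21 chain `Literature/…/Balaban1983to89/B9Thm37GlueTorusCov*` (the model of the
k-fold covariant averaging (3.15)/(3.19) and of Δ′_a = Δ_U + Q′\*aQ′ with the level sum (3.16), (3.23)–(3.24) of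
T. Bałaban, *Propagators for lattice gauge theories in a background field*, Commun. Math. Phys. 99 (1985) 389–434 =
`Balaban1985BackgroundPropagators`; the SHAPE modelled is entry 1 of (3.42), Thm 3.1 p. 397, «for an arbitrary
configuration U», and the Dirichlet inverse G′ of Ω₀Δ′_aΩ₀, p. 394).

CONTENT (all for EVERY isometric bond transport; constants see neither the transport nor the volume).
* §1 `weighted_inverse_sq_le_tower`, `entry_le_tower`: κ_k(θ) ≤ σ_k/2 ⇒ ‖e^{φ}(Δ_U + Σ_l a_lG_lᵀG_l)⁻¹g‖ ≤ (2/σ_k)‖e^{φ}g‖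
  and |(Δ_U + Σ_l a_lG_lᵀG_l)⁻¹(p, p₀)| ≤ (2/σ_k)·e^{−(φ(p) − φ(p₀))}, σ_k = `sigmaTower` of `coercive_towerOp`
  (`CovariantTowerDecay.conjErr_towerOp_ge` + `coercive_towerOp` fed into `Beta.CombesThomasFormOp.combesThomas_form_op`).
* §2 THE DIRICHLET INVERSE G′ = `dirInv (towerOp …) χ` on Ω₀ = {χ = 1}, the levels covering Ω₀ only:
  `conjErr_sandwich` (the conjugation error of Ω₀AΩ₀ + (1 − Ω₀) at v is that of A at Ω₀v), `coercive_sandwich`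
  (coercivity min(σ, 1) from coercivity σ of A on Ω₀-supported fields), `weighted_dirInv_sq_le_tower`, `dirInv_entry_le_tower`:
  |G′(p, p₀)| ≤ (2/σ′_k)·e^{−(φ(p) − φ(p₀))}, σ′_k = min(σ_k, 1), whenever κ_k(θ) ≤ σ′_k/2.
The admissible rate θ_k > 0 with κ_k(θ_k) ≤ σ/2 and the torus instance (uniform in the volume) are the companion
module `CovariantTowerDecayTorus`, which imports this one.

NOT ASSERTED: anything printed (see `CovariantTowerDecay`); ℓ²/entrywise norms, bond-step distance, crude constants;
no derivative/Hölder entries, no vector-field operators, no random-walk expansion.  Row D4: RECORDS value (NODE A.4.0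
entry 1, scalar side, at term level without an O.2 quantifier IN THE MODEL); class of (T3)/NODE O.2 unchanged; D4
DISCHARGE NO DATE; NOT BetaPertH, NOT continuum, NOT Clay.
-/

namespace Summit.QuantumFields.BalabanUV.Beta.CovariantTowerDecayCT

open Finset
open Literature.MathematicalPhysics.QuantumFieldTheory.Balaban1983to89
open B9Thm37Sum B9Thm37Glue B9Thm37GluePU B9Thm37GlueTorusInv B9Thm37GlueTorusCov B9Thm37GlueTorusCovComp
open B9Thm37GlueTorusCovPoinc (tdepth_le card_block_le)
open B9Thm37GlueTorusCovLevels B9Thm37GlueTorusCovLevelsPoinc B9Thm37GlueTorusCovTower B9Thm37GlueTorusCovTowerDir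
open B9Thm37GlueTorusCovCT (expW expW_apply conjErr conjErr_eq_matrix card_filter_bsrc_le card_filter_btgt_le
  abs_sub_dist_le)
open Literature.MathematicalPhysics.QuantumFieldTheory.Balaban1983to89.Beta.CombesThomasFormOp (combesThomas_form_op)
open Summit.QuantumFields.BalabanUV.Beta.CovariantTowerDecay
open B5TorusCover (UT Ctr)

noncomputable section

/-! ## §0  Two pieces of bookkeeping shared by the entrywise statements -/

section Entry

variable {St Cp : Type} [Fintype St] [Fintype Cp] [DecidableEq St] [DecidableEq Cp]

/-- Σ_q (e^{φ(q)}·δ_{p₀}(q))² = (e^{φ(p₀)})². [folklore] -/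
theorem sum_exp_single_sq (φ : St → ℝ) (p₀ : St × Cp) :
    ∑ q : St × Cp, (Real.exp (φ q.1) * (Pi.single p₀ (1 : ℝ) : St × Cp → ℝ) q) ^ 2 = Real.exp (φ p₀.1) ^ 2 := by
  rw [Finset.sum_eq_single p₀ (fun q _ hq => by rw [Pi.single_eq_of_ne hq, mul_zero, sq, mul_zero])
    (fun h => absurd (mem_univ p₀) h), Pi.single_eq_same, mul_one]

omit [DecidableEq St] [DecidableEq Cp] in
/-- From a weighted ℓ² bound against a point weight to an entrywise bound: Σ_q (e^{φ(q)}G(q))² ≤ C²·(e^{φ(p₀)})², C ≥ 0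
⇒ |G(p)| ≤ C·e^{−(φ(p) − φ(p₀))}. [folklore] -/
theorem abs_le_of_weighted_sq_le (φ : St → ℝ) (G : St × Cp → ℝ) {C : ℝ} (hC : 0 ≤ C) (p₀ p : St × Cp)
    (h : ∑ q, (Real.exp (φ q.1) * G q) ^ 2 ≤ C ^ 2 * Real.exp (φ p₀.1) ^ 2) :
    |G p| ≤ C * Real.exp (-(φ p.1 - φ p₀.1)) := by
  have hlhs : (Real.exp (φ p.1) * G p) ^ 2 ≤ ∑ q, (Real.exp (φ q.1) * G q) ^ 2 :=
    Finset.single_le_sum (fun q _ => sq_nonneg (Real.exp (φ q.1) * G q)) (mem_univ p)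
  have hsq : (Real.exp (φ p.1) * G p) ^ 2 ≤ (C * Real.exp (φ p₀.1)) ^ 2 := by
    rw [mul_pow C (Real.exp (φ p₀.1)) 2]
    exact hlhs.trans h
  have hb : 0 ≤ C * Real.exp (φ p₀.1) := mul_nonneg hC (Real.exp_pos _).le
  have habs := abs_le_of_sq_le_sq hsq hb
  rw [abs_mul, abs_of_pos (Real.exp_pos _)] at habs
  calc |G p| = Real.exp (-φ p.1) * (Real.exp (φ p.1) * |G p|) := by
        rw [← mul_assoc, ← Real.exp_add, neg_add_cancel, Real.exp_zero, one_mul]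
    _ ≤ Real.exp (-φ p.1) * (C * Real.exp (φ p₀.1)) := mul_le_mul_of_nonneg_left habs (Real.exp_pos _).le
    _ = C * Real.exp (-(φ p.1 - φ p₀.1)) := by
        rw [show -(φ p.1 - φ p₀.1) = φ p₀.1 + -φ p.1 by ring, Real.exp_add]
        ring

end Entry

/-! ## §1  Combes–Thomas for the tower operator: weighted ℓ² and entrywise decay, uniform in the transport -/

section Tower

variable {St Bd Cp : Type} [Fintype St] [DecidableEq St] [Fintype Bd] [Fintype Cp] [DecidableEq Cp]
  {src tgt : Bd → St} {Bs : ℕ → Type} [∀ j, Fintype (Bs j)] [∀ j, DecidableEq (Bs j)]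
  (Ks : ∀ j, Comb src tgt (Bs j)) (Rm : Bd → Cp → Cp → ℝ)

/-- **COMBES–THOMAS BOUND IN WEIGHTED ℓ² FOR THE TOWER OPERATOR, UNIFORM IN THE TRANSPORT (MODEL of the decay (3.42),
entry 1, for the multi-level Δ_U + Σ_{l≤k} a_l·G_lᵀG_l).**  Hypotheses: isometric bond matrices; c_min ≤ |c(b)| ≤ c_max
(c_min > 0); block weights |w_l| ≤ w_max; a_l ≥ 0; the k+1 levels COVER all sites with a_l ≥ a_min > 0 and
|w_l| ≥ w_min > 0 (`hcov`, as in `coercive_towerOp`); combs of depth ≤ D_j, blocks of ≤ n_j sites, bond degrees ≤ z;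
a site weight φ with |φ(b₊) − φ(b₋)| ≤ θ (θ ≥ 0) and κ_k(θ) ≤ σ_k/2, σ_k = `sigmaTower a_min w_min c_min D n k`.  Then
Σ_p (e^{φ(p)}((Δ_U + Σ a_lG_lᵀG_l)⁻¹g)(p))² ≤ (2/σ_k)²·Σ_p (e^{φ(p)}g(p))² for EVERY g. [folklore] -/
theorem weighted_inverse_sq_le_tower (hRm : ∀ b i j, ∑ k, Rm b k i * Rm b k j = if i = j then (1 : ℝ) else 0)
    {c : Bd → ℝ} {cmin cmax : ℝ} (hcmin : 0 < cmin) (hc : ∀ b, cmin ≤ |c b|) (hc' : ∀ b, |c b| ≤ cmax)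
    {D n : ℕ → ℕ} (hD : ∀ j x, (Ks j).depth x ≤ D j)
    (hn : ∀ j β, (univ.filter fun x => (Ks j).blk x = β).card ≤ n j) (k : ℕ) (w : Fin (k + 1) → St → ℝ)
    {wmax : ℝ} (hw' : ∀ l y, |w l y| ≤ wmax) {a : Fin (k + 1) → ℝ} (ha : ∀ l, 0 ≤ a l) {amin wmin : ℝ}
    (hamin : 0 < amin) (hwmin : 0 < wmin)
    (hcov : ∀ x, ∃ l : Fin (k + 1), amin ≤ a l ∧ wmin ≤ |w l (towerBlk Ks (l : ℕ) x)|)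
    {θ : ℝ} (hθ : 0 ≤ θ) (φ : St → ℝ) (hφ : ∀ b, |φ (tgt b) - φ (src b)| ≤ θ) {z : ℕ}
    (hzs : ∀ x, (univ.filter fun b => src b = x).card ≤ z) (hzt : ∀ x, (univ.filter fun b => tgt b = x).card ≤ z)
    (hκ : kappaTower θ cmax wmax z D n k a ≤ sigmaTower amin wmin cmin D n k / 2) (g : St × Cp → ℝ) :
    ∑ p, (Real.exp (φ p.1) *
        Ring.inverse (towerOp Ks Rm c k (fun l x => w l (towerBlk Ks (l : ℕ) x)) a) g p) ^ 2 ≤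
      (2 / sigmaTower amin wmin cmin D n k) ^ 2 * ∑ p, (Real.exp (φ p.1) * g p) ^ 2 := by
  set A := towerOp Ks Rm c k (fun l x => w l (towerBlk Ks (l : ℕ) x)) a with hA
  set σ := sigmaTower amin wmin cmin D n k with hσdef
  have hσ : 0 < σ := sigmaTower_pos cmin D n k hamin hwmin
  set H := LinearMap.toMatrix' A with hH
  have hmv : ∀ u : St × Cp → ℝ, H.mulVec u = A u := fun u => by
    rw [hH, ← Matrix.toLin'_apply, Matrix.toLin'_toMatrix']
  have hdot : ∀ u : St × Cp → ℝ, u ⬝ᵥ u = ∑ p, u p ^ 2 := fun u => Finset.sum_congr rfl fun p _ => (sq _).symm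
  have hpos : ∀ ω : St × Cp → ℝ, σ * (ω ⬝ᵥ ω) ≤ ω ⬝ᵥ H.mulVec ω := by
    intro ω
    rw [hmv, hdot]
    exact coercive_towerOp Ks Rm hRm hcmin hc hD hn k w ha hamin hwmin ω fun x _ _ => hcov x
  have herr : ∀ u : St × Cp → ℝ, -(σ / 2) * (u ⬝ᵥ u) ≤
      ∑ j, ∑ k', (Real.exp ((fun p : St × Cp => φ p.1) j - (fun p : St × Cp => φ p.1) k') - 1) * H j k' *
        (u j * u k') := by
    intro u
    rw [hdot]
    have h := conjErr_towerOp_ge Ks Rm hRm hc' hD hn k (W := fun l x => w l (towerBlk Ks (l : ℕ) x))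
      (fun l x => hw' l _) ha hθ φ hφ hzs hzt u
    rw [conjErr_eq_matrix] at h
    have h0 : 0 ≤ ∑ p, u p ^ 2 := Finset.sum_nonneg fun p _ => sq_nonneg _
    have h1 : kappaTower θ cmax wmax z D n k a * ∑ p, u p ^ 2 ≤ σ / 2 * ∑ p, u p ^ 2 :=
      mul_le_mul_of_nonneg_right hκ h0
    simp only
    linarith
  have hv : H.mulVec (Ring.inverse A g) = g := by
    rw [hmv]
    have h := mul_inverse_towerOp Ks Rm hRm hcmin hc hD hn k w ha hamin hwmin hcov
    have := congrArg (fun T : Module.End ℝ (St × Cp → ℝ) => T g) h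
    simpa [Module.End.mul_apply] using this
  exact combesThomas_form_op H σ (fun p : St × Cp => φ p.1) hσ hpos herr g (Ring.inverse A g) hv

/-- **ENTRYWISE COMBES–THOMAS DECAY OF THE TOWER INVERSE, UNIFORM IN THE TRANSPORT (MODEL of (3.42), entry 1, for the
multi-level operator).**  Under the hypotheses of `weighted_inverse_sq_le_tower`:
|(Δ_U + Σ_{l≤k} a_l·G_lᵀG_l)⁻¹(p, p₀)| ≤ (2/σ_k)·e^{−(φ(p) − φ(p₀))} for all p, p₀ and EVERY bond-θ-Lipschitz site weight φ
with κ_k(θ) ≤ σ_k/2. [folklore] -/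
theorem entry_le_tower (hRm : ∀ b i j, ∑ k, Rm b k i * Rm b k j = if i = j then (1 : ℝ) else 0)
    {c : Bd → ℝ} {cmin cmax : ℝ} (hcmin : 0 < cmin) (hc : ∀ b, cmin ≤ |c b|) (hc' : ∀ b, |c b| ≤ cmax)
    {D n : ℕ → ℕ} (hD : ∀ j x, (Ks j).depth x ≤ D j)
    (hn : ∀ j β, (univ.filter fun x => (Ks j).blk x = β).card ≤ n j) (k : ℕ) (w : Fin (k + 1) → St → ℝ)
    {wmax : ℝ} (hw' : ∀ l y, |w l y| ≤ wmax) {a : Fin (k + 1) → ℝ} (ha : ∀ l, 0 ≤ a l) {amin wmin : ℝ}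
    (hamin : 0 < amin) (hwmin : 0 < wmin)
    (hcov : ∀ x, ∃ l : Fin (k + 1), amin ≤ a l ∧ wmin ≤ |w l (towerBlk Ks (l : ℕ) x)|)
    {θ : ℝ} (hθ : 0 ≤ θ) (φ : St → ℝ) (hφ : ∀ b, |φ (tgt b) - φ (src b)| ≤ θ) {z : ℕ}
    (hzs : ∀ x, (univ.filter fun b => src b = x).card ≤ z) (hzt : ∀ x, (univ.filter fun b => tgt b = x).card ≤ z)
    (hκ : kappaTower θ cmax wmax z D n k a ≤ sigmaTower amin wmin cmin D n k / 2) (p₀ p : St × Cp) :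
    |Ring.inverse (towerOp Ks Rm c k (fun l x => w l (towerBlk Ks (l : ℕ) x)) a) (Pi.single p₀ 1) p| ≤
      2 / sigmaTower amin wmin cmin D n k * Real.exp (-(φ p.1 - φ p₀.1)) := by
  have h := weighted_inverse_sq_le_tower Ks Rm hRm hcmin hc hc' hD hn k w hw' ha hamin hwmin hcov hθ φ hφ hzs hzt
    hκ (Pi.single p₀ 1)
  rw [sum_exp_single_sq] at h
  exact abs_le_of_weighted_sq_le φ _
    (div_nonneg zero_le_two (sigmaTower_pos cmin D n k hamin hwmin).le) p₀ p h

/-! ## §2  The Dirichlet inverse on Ω₀ = {χ = 1} -/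

omit [DecidableEq St] [Fintype Bd] [DecidableEq Cp] in
/-- **The conjugation error of a Dirichlet sandwich**: ERR_φ(Ω₀AΩ₀ + (1 − Ω₀); v) = ERR_φ(A; Ω₀v) (the multiplication
operators commute with the conjugation; the identity block contributes nothing). [folklore] -/
theorem conjErr_sandwich (A : Module.End ℝ (St × Cp → ℝ)) (χ : St × Cp → ℝ) (φ : St → ℝ) (v : St × Cp → ℝ) :
    conjErr (mulOp χ * A * mulOp χ + mulOp (1 - χ) : Module.End ℝ (St × Cp → ℝ)) φ v =
      conjErr A φ (fun p => χ p * v p) := by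
  have eχ : ∀ ψ : St → ℝ, mulOp χ (expW ψ v) = expW ψ (fun p => χ p * v p) := fun ψ =>
    funext fun p => by simp only [mulOp_apply, expW]; ring
  have eχ' : mulOp χ v = fun p => χ p * v p := funext fun p => mulOp_apply χ v p
  have hee : ∀ p : St × Cp, expW φ v p * expW (fun x => -φ x) v p = v p * v p := fun p => by
    simp only [expW]
    rw [mul_mul_mul_comm, ← Real.exp_add, add_neg_cancel, Real.exp_zero, one_mul]
  have hu : ∀ p : St × Cp, expW φ (fun p => χ p * v p) p = χ p * expW φ v p := fun p => by
    simp only [expW]; ring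
  have h1 : ∑ p, expW φ v p *
      (mulOp χ * A * mulOp χ + mulOp (1 - χ) : Module.End ℝ (St × Cp → ℝ)) (expW (fun x => -φ x) v) p =
      ∑ p, expW φ (fun p => χ p * v p) p * A (expW (fun x => -φ x) (fun p => χ p * v p)) p +
        ∑ p, (1 - χ p) * (v p * v p) := by
    rw [← Finset.sum_add_distrib]
    refine Finset.sum_congr rfl fun p _ => ?_
    simp only [LinearMap.add_apply, Pi.add_apply, Module.End.mul_apply, eχ, mulOp_apply, Pi.sub_apply,
      Pi.one_apply]
    rw [hu p, ← hee p]
    ring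
  have h2 : ∑ p, v p * (mulOp χ * A * mulOp χ + mulOp (1 - χ) : Module.End ℝ (St × Cp → ℝ)) v p =
      ∑ p, (fun p => χ p * v p) p * A (fun p => χ p * v p) p + ∑ p, (1 - χ p) * (v p * v p) := by
    rw [← Finset.sum_add_distrib]
    refine Finset.sum_congr rfl fun p _ => ?_
    simp only [LinearMap.add_apply, Pi.add_apply, Module.End.mul_apply, eχ', mulOp_apply, Pi.sub_apply,
      Pi.one_apply]
    ring
  unfold conjErr
  rw [h1, h2]
  ring

omit [DecidableEq St] [Fintype Bd] [DecidableEq Cp] in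
/-- **Coercivity of the Dirichlet sandwich**: χ {0,1}-valued and σ‖f‖² ≤ ⟨f, Af⟩ for every f supported in {χ = 1},
with σ ≤ 1 ⇒ σ‖f‖² ≤ ⟨f, (Ω₀AΩ₀ + (1 − Ω₀))f⟩ for EVERY f. [folklore] -/
theorem coercive_sandwich (A : Module.End ℝ (St × Cp → ℝ)) {χ : St × Cp → ℝ} (hχ : ∀ p, χ p = 0 ∨ χ p = 1)
    {σ : ℝ} (hσ1 : σ ≤ 1)
    (hco : ∀ f : St × Cp → ℝ, (∀ p, f p ≠ 0 → χ p = 1) → σ * ∑ p, f p ^ 2 ≤ ∑ p, f p * A f p)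
    (f : St × Cp → ℝ) :
    σ * ∑ p, f p ^ 2 ≤ ∑ p, f p * (mulOp χ * A * mulOp χ + mulOp (1 - χ) : Module.End ℝ (St × Cp → ℝ)) f p := by
  have hsplit : ∑ p, f p * (mulOp χ * A * mulOp χ + mulOp (1 - χ) : Module.End ℝ (St × Cp → ℝ)) f p =
      ∑ p, (mulOp χ f) p * A (mulOp χ f) p + ∑ p, (1 - χ p) * f p ^ 2 := by
    rw [← Finset.sum_add_distrib]
    refine Finset.sum_congr rfl fun p _ => ?_
    simp only [LinearMap.add_apply, Pi.add_apply, Module.End.mul_apply, mulOp_apply, Pi.sub_apply, Pi.one_apply]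
    ring
  have hsuppχ : ∀ p, mulOp χ f p ≠ 0 → χ p = 1 := fun p hp => by
    rcases hχ p with h | h
    · exact absurd (by rw [mulOp_apply, h, zero_mul]) hp
    · exact h
  have h1 := hco (mulOp χ f) hsuppχ
  have hsq : ∑ p, f p ^ 2 = ∑ p, (mulOp χ f) p ^ 2 + ∑ p, (1 - χ p) * f p ^ 2 := by
    rw [← Finset.sum_add_distrib]
    refine Finset.sum_congr rfl fun p _ => ?_
    rw [mulOp_apply]
    rcases hχ p with h | h <;> simp [h]
  have hnn : 0 ≤ ∑ p, (1 - χ p) * f p ^ 2 :=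
    Finset.sum_nonneg fun p _ => mul_nonneg (by rcases hχ p with h | h <;> simp [h]) (sq_nonneg _)
  rw [hsplit, hsq, mul_add]
  have : σ * ∑ p, (1 - χ p) * f p ^ 2 ≤ ∑ p, (1 - χ p) * f p ^ 2 := by nlinarith
  linarith

omit [∀ j, Fintype (Bs j)] in
/-- κ_k(θ) ≥ 0 for θ ≥ 0 and a_l ≥ 0. [folklore] -/
theorem kappaTower_nonneg {θ : ℝ} (hθ : 0 ≤ θ) (cmax wmax : ℝ) (z : ℕ) (D n : ℕ → ℕ) (k : ℕ)
    {a : Fin (k + 1) → ℝ} (ha : ∀ l, 0 ≤ a l) : 0 ≤ kappaTower θ cmax wmax z D n k a := by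
  unfold kappaTower
  refine add_nonneg (mul_nonneg (mul_nonneg (sq_nonneg _) ?_) (Nat.cast_nonneg _))
    (Finset.sum_nonneg fun l _ => mul_nonneg (ha l) (mul_nonneg (mul_nonneg (sq_nonneg _) ?_) (Nat.cast_nonneg _)))
  · linarith [Real.one_le_exp_iff.mpr hθ]
  · have : 0 ≤ 2 * (towerS D l : ℝ) * θ := by positivity
    linarith [Real.one_le_exp_iff.mpr this]

/-- **COMBES–THOMAS IN WEIGHTED ℓ² FOR THE DIRICHLET INVERSE OF THE TOWER OPERATOR ON Ω₀ = {χ = 1} (MODEL of the decay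
of G′, p. 394 / (3.42) entry 1).**  As `weighted_inverse_sq_le_tower`, but the levels need cover Ω₀ only (`hcov` on
{χ = 1}) and the smallness is κ_k(θ) ≤ min(σ_k, 1)/2:  Σ_p (e^{φ(p)}(G′g)(p))² ≤ (2/min(σ_k,1))²·Σ_p (e^{φ(p)}g(p))²,
G′ = `dirInv (towerOp …) χ`. [folklore] -/
theorem weighted_dirInv_sq_le_tower (hRm : ∀ b i j, ∑ k, Rm b k i * Rm b k j = if i = j then (1 : ℝ) else 0)
    {c : Bd → ℝ} {cmin cmax : ℝ} (hcmin : 0 < cmin) (hc : ∀ b, cmin ≤ |c b|) (hc' : ∀ b, |c b| ≤ cmax)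
    {D n : ℕ → ℕ} (hD : ∀ j x, (Ks j).depth x ≤ D j)
    (hn : ∀ j β, (univ.filter fun x => (Ks j).blk x = β).card ≤ n j) (k : ℕ) (w : Fin (k + 1) → St → ℝ)
    {wmax : ℝ} (hw' : ∀ l y, |w l y| ≤ wmax) {a : Fin (k + 1) → ℝ} (ha : ∀ l, 0 ≤ a l) {amin wmin : ℝ}
    (hamin : 0 < amin) (hwmin : 0 < wmin) {χ : St × Cp → ℝ} (hχ : ∀ p, χ p = 0 ∨ χ p = 1)
    (hcov : ∀ x i, χ (x, i) = 1 → ∃ l : Fin (k + 1), amin ≤ a l ∧ wmin ≤ |w l (towerBlk Ks (l : ℕ) x)|)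
    {θ : ℝ} (hθ : 0 ≤ θ) (φ : St → ℝ) (hφ : ∀ b, |φ (tgt b) - φ (src b)| ≤ θ) {z : ℕ}
    (hzs : ∀ x, (univ.filter fun b => src b = x).card ≤ z) (hzt : ∀ x, (univ.filter fun b => tgt b = x).card ≤ z)
    (hκ : kappaTower θ cmax wmax z D n k a ≤ min (sigmaTower amin wmin cmin D n k) 1 / 2) (g : St × Cp → ℝ) :
    ∑ p, (Real.exp (φ p.1) * dirInv (towerOp Ks Rm c k (fun l x => w l (towerBlk Ks (l : ℕ) x)) a) χ g p) ^ 2 ≤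
      (2 / min (sigmaTower amin wmin cmin D n k) 1) ^ 2 * ∑ p, (Real.exp (φ p.1) * g p) ^ 2 := by
  set A := towerOp Ks Rm c k (fun l x => w l (towerBlk Ks (l : ℕ) x)) a with hA
  set S : Module.End ℝ (St × Cp → ℝ) := mulOp χ * A * mulOp χ + mulOp (1 - χ) with hSdef
  set σ := min (sigmaTower amin wmin cmin D n k) 1 with hσdef
  have hσ : 0 < σ := lt_min (sigmaTower_pos cmin D n k hamin hwmin) one_pos
  -- coercivity of the sandwich
  have hcoA : ∀ f : St × Cp → ℝ, (∀ p, f p ≠ 0 → χ p = 1) → σ * ∑ p, f p ^ 2 ≤ ∑ p, f p * A f p := by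
    intro f hf
    have h := coercive_towerOp Ks Rm hRm hcmin hc hD hn k w ha hamin hwmin f fun x i hx => hcov x i (hf (x, i) hx)
    have h0 : 0 ≤ ∑ p, f p ^ 2 := Finset.sum_nonneg fun p _ => sq_nonneg _
    exact (mul_le_mul_of_nonneg_right (min_le_left _ _) h0).trans h
  have hcoS : ∀ f : St × Cp → ℝ, σ * ∑ p, f p ^ 2 ≤ ∑ p, f p * S f p :=
    coercive_sandwich A hχ (min_le_right _ _) hcoA
  set H := LinearMap.toMatrix' S with hH
  have hmv : ∀ u : St × Cp → ℝ, H.mulVec u = S u := fun u => by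
    rw [hH, ← Matrix.toLin'_apply, Matrix.toLin'_toMatrix']
  have hdot : ∀ u : St × Cp → ℝ, u ⬝ᵥ u = ∑ p, u p ^ 2 := fun u => Finset.sum_congr rfl fun p _ => (sq _).symm
  have hpos : ∀ ω : St × Cp → ℝ, σ * (ω ⬝ᵥ ω) ≤ ω ⬝ᵥ H.mulVec ω := by
    intro ω
    rw [hmv, hdot]
    exact hcoS ω
  have herr : ∀ u : St × Cp → ℝ, -(σ / 2) * (u ⬝ᵥ u) ≤
      ∑ j, ∑ k', (Real.exp ((fun p : St × Cp => φ p.1) j - (fun p : St × Cp => φ p.1) k') - 1) * H j k' *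
        (u j * u k') := by
    intro u
    rw [hdot]
    have h := conjErr_towerOp_ge Ks Rm hRm hc' hD hn k (W := fun l x => w l (towerBlk Ks (l : ℕ) x))
      (fun l x => hw' l _) ha hθ φ hφ hzs hzt (fun p => χ p * u p)
    rw [← conjErr_sandwich, conjErr_eq_matrix] at h
    have hχu : ∑ p, (χ p * u p) ^ 2 ≤ ∑ p, u p ^ 2 :=
      Finset.sum_le_sum fun p _ => by rcases hχ p with h | h <;> simp [h, sq_nonneg]
    have hκ0 := kappaTower_nonneg hθ cmax wmax z D n k ha
    have h0 : 0 ≤ ∑ p, u p ^ 2 := Finset.sum_nonneg fun p _ => sq_nonneg _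
    have h1 : kappaTower θ cmax wmax z D n k a * ∑ p, u p ^ 2 ≤ σ / 2 * ∑ p, u p ^ 2 :=
      mul_le_mul_of_nonneg_right hκ h0
    have h2 : kappaTower θ cmax wmax z D n k a * ∑ p, (χ p * u p) ^ 2 ≤
        kappaTower θ cmax wmax z D n k a * ∑ p, u p ^ 2 := mul_le_mul_of_nonneg_left hχu hκ0
    simp only
    linarith
  -- S is invertible and S⁻¹(χg) solves the equation
  have hSpos := posDef_of_coercive S hσ hcoS
  have hv : H.mulVec (Ring.inverse S (mulOp χ g)) = mulOp χ g := by
    rw [hmv]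
    have h := mul_inverse_of_posDef hSpos
    have := congrArg (fun T : Module.End ℝ (St × Cp → ℝ) => T (mulOp χ g)) h
    simpa [Module.End.mul_apply] using this
  have hCT := combesThomas_form_op H σ (fun p : St × Cp => φ p.1) hσ hpos herr (mulOp χ g)
    (Ring.inverse S (mulOp χ g)) hv
  -- dirInv A χ g = χ·S⁻¹(χ g)
  have hdir : ∀ p, dirInv A χ g p = χ p * Ring.inverse S (mulOp χ g) p := fun p => by
    simp only [dirInv, ← hSdef, Module.End.mul_apply, mulOp_apply]
  have hl : ∑ p, (Real.exp (φ p.1) * dirInv A χ g p) ^ 2 ≤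
      ∑ p, (Real.exp (φ p.1) * Ring.inverse S (mulOp χ g) p) ^ 2 :=
    Finset.sum_le_sum fun p _ => by
      rw [hdir p]
      rcases hχ p with h | h <;> simp [h, sq_nonneg]
  have hr : ∑ p, (Real.exp (φ p.1) * mulOp χ g p) ^ 2 ≤ ∑ p, (Real.exp (φ p.1) * g p) ^ 2 :=
    Finset.sum_le_sum fun p _ => by
      rw [mulOp_apply]
      rcases hχ p with h | h <;> simp [h, sq_nonneg]
  have h4 : 0 ≤ (2 / σ) ^ 2 := sq_nonneg _
  calc _ ≤ _ := hl
    _ ≤ (2 / σ) ^ 2 * ∑ p, (Real.exp (φ p.1) * mulOp χ g p) ^ 2 := hCT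
    _ ≤ (2 / σ) ^ 2 * ∑ p, (Real.exp (φ p.1) * g p) ^ 2 := mul_le_mul_of_nonneg_left hr h4

/-- **ENTRYWISE COMBES–THOMAS DECAY OF THE DIRICHLET INVERSE OF THE TOWER OPERATOR ON Ω₀, UNIFORM IN THE TRANSPORT
(MODEL).**  Under the hypotheses of `weighted_dirInv_sq_le_tower`: |G′(p, p₀)| ≤ (2/min(σ_k,1))·e^{−(φ(p) − φ(p₀))}.
[folklore] -/
theorem dirInv_entry_le_tower (hRm : ∀ b i j, ∑ k, Rm b k i * Rm b k j = if i = j then (1 : ℝ) else 0)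
    {c : Bd → ℝ} {cmin cmax : ℝ} (hcmin : 0 < cmin) (hc : ∀ b, cmin ≤ |c b|) (hc' : ∀ b, |c b| ≤ cmax)
    {D n : ℕ → ℕ} (hD : ∀ j x, (Ks j).depth x ≤ D j)
    (hn : ∀ j β, (univ.filter fun x => (Ks j).blk x = β).card ≤ n j) (k : ℕ) (w : Fin (k + 1) → St → ℝ)
    {wmax : ℝ} (hw' : ∀ l y, |w l y| ≤ wmax) {a : Fin (k + 1) → ℝ} (ha : ∀ l, 0 ≤ a l) {amin wmin : ℝ}
    (hamin : 0 < amin) (hwmin : 0 < wmin) {χ : St × Cp → ℝ} (hχ : ∀ p, χ p = 0 ∨ χ p = 1)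
    (hcov : ∀ x i, χ (x, i) = 1 → ∃ l : Fin (k + 1), amin ≤ a l ∧ wmin ≤ |w l (towerBlk Ks (l : ℕ) x)|)
    {θ : ℝ} (hθ : 0 ≤ θ) (φ : St → ℝ) (hφ : ∀ b, |φ (tgt b) - φ (src b)| ≤ θ) {z : ℕ}
    (hzs : ∀ x, (univ.filter fun b => src b = x).card ≤ z) (hzt : ∀ x, (univ.filter fun b => tgt b = x).card ≤ z)
    (hκ : kappaTower θ cmax wmax z D n k a ≤ min (sigmaTower amin wmin cmin D n k) 1 / 2) (p₀ p : St × Cp) :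
    |dirInv (towerOp Ks Rm c k (fun l x => w l (towerBlk Ks (l : ℕ) x)) a) χ (Pi.single p₀ 1) p| ≤
      2 / min (sigmaTower amin wmin cmin D n k) 1 * Real.exp (-(φ p.1 - φ p₀.1)) := by
  have h := weighted_dirInv_sq_le_tower Ks Rm hRm hcmin hc hc' hD hn k w hw' ha hamin hwmin hχ hcov hθ φ hφ hzs hzt
    hκ (Pi.single p₀ 1)
  rw [sum_exp_single_sq] at h
  exact abs_le_of_weighted_sq_le φ _
    (div_nonneg zero_le_two (lt_min (sigmaTower_pos cmin D n k hamin hwmin) one_pos).le) p₀ p h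

end Tower

end

end Summit.QuantumFields.BalabanUV.Beta.CovariantTowerDecayCT
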